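import Summits.CriticalPhenomena.Ising3D.Control2DCellCheck
import Summits.CriticalPhenomena.Ising3D.Control2DMidSound
import Mathlib.Tactic.NormNum
import HarnessLib

/-!
# The 2D control: soundness of the kernel checker for obligation (C)
(cell `pub-ising3x`, seat controls-1; companion of `Control2DCellCheck.lean` / `Control2DCellScheme.lean`)

HONEST FRAMING: lottery ticket; floor = tightest certified 3D Ising CFT bounds; no exact-solution
claim without a proof.

Inclusion theorems for the (C) checker: the chiral coefficient recursion in intervals (`coefs_mem`),
Horner (`hornerL_mem`) and the series table (`Atab_mem`), dyadic powers (`dyPow_mem`), the block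
factor (`brOf_mem`), a point (`pointC_spec`). The cell / cut-list layer (`sums4_spec`, `checkSpin_sound`,
`cellPositive_of_checkSpin`) is the companion `Control2DCellSpin.lean`. All PROVED.
-/

namespace Summit.CriticalPhenomena.Ising3D.Control2D

open Set Finset
open Literature.MathematicalPhysics.QuantumFieldTheory.ConformalBootstrap3D

/-! ### What the kernel data enclose -/

/-- What a (C) kernel datum asserts about a real datum (value list `vals`, spin `ℓ`). [folklore] -/
structure CDat.Models (P : ℕ) (vals : List ℚ) (ℓ : ℕ) (d : CDat) (r : RDat) : Prop where
  /-- same sign -/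
  sign : d.pos = r.σ
  /-- `|c_d|` enclosed -/
  cabs : d.cabs.mem P r.c
  /-- `x` is value number `ix` -/
  ix_lt : d.ix < vals.length
  /-- `x` is value number `ix` -/
  x_eq : ∀ h : d.ix < vals.length, ((vals[d.ix] : ℚ) : ℝ) = r.x
  /-- `y` is value number `iy` -/
  iy_lt : d.iy < vals.length
  /-- `y` is value number `iy` -/
  y_eq : ∀ h : d.iy < vals.length, ((vals[d.iy] : ℚ) : ℝ) = r.y
  /-- denominator positive -/
  xyd_pos : 0 < d.xyd
  /-- `xy = xyn / xyd` -/
  xy_eq : r.x * r.y = (d.xyn : ℝ) / d.xyd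
  /-- `(x/y)^{ℓ/2}` enclosed -/
  r1 : d.r1.mem P ((r.x / r.y) ^ (ℓ / 2))
  /-- `(y/x)^{ℓ/2}` enclosed -/
  r2 : d.r2.mem P ((r.y / r.x) ^ (ℓ / 2))
  /-- the chain encloses the dyadic roots of `xy` -/
  chain : ∀ (k : ℕ) (hk : k < d.ch.length), (d.ch[k]).mem P ((r.x * r.y) ^ ((1 : ℝ) / 2 ^ (k + 1)))

/-- `mkCDat` models the corresponding real datum (coordinates in the value list). [folklore] -/
theorem mkCDat_models (P depth ℓ : ℕ) {vals : List ℚ} (pos : Bool) {wabs base x y : ℚ}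
    (hw : 0 ≤ wabs) (hb : 0 ≤ base) (hx : 0 < x) (hy : 0 < y) (hxv : x ∈ vals) (hyv : y ∈ vals) :
    (mkCDat P depth ℓ vals pos wabs base x y).Models P vals ℓ
      ⟨pos, (wabs : ℝ) * (base : ℝ) ^ ((1 : ℝ) / 8), (x : ℝ), (y : ℝ)⟩ where
  sign := rfl
  cabs := by
    have h := NI.mem_sqrtIter (P := P) (by exact_mod_cast hb : (0 : ℝ) ≤ (base : ℝ))
      (NI.mem_ofRat P hb) 3
    have e : ((1 : ℝ) / 2 ^ 3) = 1 / 8 := by norm_num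
    rw [e] at h
    exact NI.mem_mul (NI.mem_ofRat P hw) h
  ix_lt := List.idxOf_lt_length_iff.2 hxv
  x_eq := fun h => by simp [mkCDat, List.getElem_idxOf]
  iy_lt := List.idxOf_lt_length_iff.2 hyv
  y_eq := fun h => by simp [mkCDat, List.getElem_idxOf]
  xyd_pos := (x * y).den_pos
  xy_eq := by
    have := rat_cast_eq_toNat_div (mul_nonneg hx.le hy.le)
    push_cast at this
    exact this
  r1 := by
    have h := NI.mem_ofRat P (q := (x / y) ^ (ℓ / 2)) (by positivity)
    push_cast at h
    exact h
  r2 := by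
    have h := NI.mem_ofRat P (q := (y / x) ^ (ℓ / 2)) (by positivity)
    push_cast at h
    exact h
  chain := by
    intro k hk
    have hxy : (0 : ℝ) ≤ (x : ℝ) * (y : ℝ) := mul_nonneg (by exact_mod_cast hx.le) (by exact_mod_cast hy.le)
    exact sqrtChain_mem P depth hxy (by simpa using NI.mem_ofRat P (mul_nonneg hx.le hy.le)) k hk

/-- `mkCData` models `realData`, entry by entry, when all coordinates are in the value list.
[folklore] -/
theorem mkCData_models {n : ℕ} (P depth ℓ : ℕ) (vals : List ℚ) (w z zb : Fin n → ℚ)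
    (hz : ∀ k, 0 < z k ∧ z k < 1) (hzb : ∀ k, 0 < zb k ∧ zb k < 1)
    (hv : ∀ k, z k ∈ vals ∧ zb k ∈ vals ∧ 1 - z k ∈ vals ∧ 1 - zb k ∈ vals) :
    List.Forall₂ (CDat.Models P vals ℓ) (mkCData P depth ℓ vals w z zb) (realData w z zb) := by
  unfold mkCData realData
  refine List.rel_append (forall₂_ofFn fun k => ?_) (forall₂_ofFn fun k => ?_)
  · have h := mkCDat_models P depth ℓ (decide (0 ≤ w k)) (abs_nonneg (w k))
      (mul_nonneg (by linarith [(hz k).2]) (by linarith [(hzb k).2]) : (0 : ℚ) ≤ (1 - z k) * (1 - zb k))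
      (hz k).1 (hzb k).1 (hv k).1 (hv k).2.1
    push_cast at h
    exact h
  · have h := mkCDat_models P depth ℓ (decide (w k ≤ 0)) (abs_nonneg (w k))
      (mul_nonneg (hz k).1.le (hzb k).1.le)
      (by linarith [(hz k).2] : (0 : ℚ) < 1 - z k) (by linarith [(hzb k).2] : (0 : ℚ) < 1 - zb k)
      (hv k).2.2.1 (hv k).2.2.2
    push_cast at h
    exact h

/-! ### The chiral series -/

/-- `facQ η m` is the real factor `chiralFactor m η`. [folklore] -/
theorem facQ_cast (η : ℚ) (m : ℕ) : ((facQ η m : ℚ) : ℝ) = chiralFactor m (η : ℝ) := by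
  unfold facQ chiralFactor
  split_ifs <;> push_cast <;> ring

/-- `facQ η m ≥ 0` for `η ≥ 0`. [folklore] -/
theorem facQ_nonneg {η : ℚ} (hη : 0 ≤ η) (m : ℕ) : 0 ≤ facQ η m := by
  unfold facQ; split_ifs <;> positivity

/-- [folklore] -/
theorem coefsAux_length (P : ℕ) (η : ℚ) : ∀ (k m : ℕ) (a : NI), (coefsAux P η k m a).length = k
  | 0, _, _ => rfl
  | k + 1, m, a => by simp [coefsAux, coefsAux_length P η k]

/-- The recursion encloses the coefficients: entry `i` of `coefsAux k m a` encloses `a_{m+i}(η)` when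
`a ∋ a_m(η)` (`η ≥ 0`). [folklore] -/
theorem coefsAux_mem (P : ℕ) {η : ℚ} (hη : 0 ≤ η) :
    ∀ (k m : ℕ) {a : NI}, a.mem P (chiralCoeff (η : ℝ) m) →
      ∀ (i : ℕ) (hi : i < (coefsAux P η k m a).length),
        ((coefsAux P η k m a)[i]).mem P (chiralCoeff (η : ℝ) (m + i))
  | 0, m, a, _, i, hi => by simp [coefsAux] at hi
  | k + 1, m, a, ha, i, hi => by
    have hη' : (0 : ℝ) ≤ (η : ℝ) := by exact_mod_cast hη
    have hnext : (a.mul P (NI.ofRat P (facQ η m))).mem P (chiralCoeff (η : ℝ) (m + 1)) := by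
      have e : chiralCoeff (η : ℝ) (m + 1) = chiralCoeff (η : ℝ) m * ((facQ η m : ℚ) : ℝ) := by
        rw [chiralCoeff_eq_prod hη', chiralCoeff_eq_prod hη', chiralProd, chiralProd, prod_range_succ,
          facQ_cast]
      rw [e]; exact NI.mem_mul ha (NI.mem_ofRat P (facQ_nonneg hη m))
    cases i with
    | zero => simpa [coefsAux] using ha
    | succ i =>
      have hi' : i < (coefsAux P η k (m + 1) (a.mul P (NI.ofRat P (facQ η m)))).length := by
        simp [coefsAux, coefsAux_length] at hi ⊢; omega
      have := coefsAux_mem P hη k (m + 1) hnext i hi'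
      rw [show m + 1 + i = m + (i + 1) by ring] at this
      simpa [coefsAux] using this

/-- `coefs P N η` has length `N` and entry `i` encloses `a_i(η)` (`η ≥ 0`). [folklore] -/
theorem coefs_mem (P N : ℕ) {η : ℚ} (hη : 0 ≤ η) (i : ℕ) (hi : i < (coefs P N η).length) :
    ((coefs P N η)[i]).mem P (chiralCoeff (η : ℝ) i) := by
  have h0 : (NI.one P).mem P (chiralCoeff (η : ℝ) 0) := by
    have : chiralCoeff (η : ℝ) 0 = 1 := by
      rw [chiralCoeff_eq_prod (by exact_mod_cast hη)]; simp [chiralProd]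
    rw [this]; exact NI.mem_one P
  have := coefsAux_mem P hη N 0 h0 i hi
  rw [Nat.zero_add] at this
  exact this

/-- [folklore] -/
theorem coefs_length (P N : ℕ) (η : ℚ) : (coefs P N η).length = N := coefsAux_length P η N 0 _

/-- Horner encloses the truncated series: for coefficient enclosures `cs[i] ∋ c_i` and `v ∋ x`,
`hornerL v cs ∋ Σ_{i<|cs|} c_i x^i`. [folklore] -/
theorem hornerL_mem (P : ℕ) {v : NI} {x : ℝ} (hv : v.mem P x) :
    ∀ (cs : List NI) (c : ℕ → ℝ), (∀ (i : ℕ) (hi : i < cs.length), (cs[i]).mem P (c i)) →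
      (hornerL P v cs).mem P (∑ i ∈ range cs.length, c i * x ^ i)
  | [], c, _ => by simpa [hornerL] using NI.mem_zero P
  | a :: rest, c, h => by
    have ha : a.mem P (c 0) := h 0 (by simp)
    have hrest := hornerL_mem P hv rest (fun i => c (i + 1)) fun i hi => h (i + 1) (by simpa using hi)
    have e : ∑ i ∈ range (a :: rest).length, c i * x ^ i =
        c 0 + (∑ i ∈ range rest.length, c (i + 1) * x ^ i) * x := by
      rw [List.length_cons, sum_range_succ', sum_mul, pow_zero, mul_one, add_comm]
      congr 1
      refine sum_congr rfl fun i _ => ?_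
      rw [pow_succ]; ring
    rw [e]
    simpa [hornerL] using NI.mem_add ha (NI.mem_mul hrest hv)

/-- The series table: entry `j` of `Atab P N η (vals.map ofRat)` encloses `AN N η vals[j]`
(`η ≥ 0`, values `≥ 0`). [folklore] -/
theorem Atab_mem (P N : ℕ) {η : ℚ} (hη : 0 ≤ η) (vals : List ℚ) (hvals : ∀ q ∈ vals, 0 ≤ q) (j : ℕ)
    (hj : j < vals.length) :
    ((Atab P N η (vals.map (NI.ofRat P))).getD j NI.zero).mem P (AN N (η : ℝ) ((vals[j] : ℚ) : ℝ)) := by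
  unfold Atab
  rw [List.getD_eq_getElem _ _ (by simpa using hj)]
  simp only [List.getElem_map]
  have hv := NI.mem_ofRat P (hvals _ (List.getElem_mem hj))
  have := hornerL_mem P hv (coefs P N η) (fun i => chiralCoeff (η : ℝ) i) (coefs_mem P N hη)
  rw [coefs_length] at this
  exact this

/-! ### Dyadic powers and the block factor -/

/-- `chAtC k ∋ (xy)^{1/2^{k+1}}` (beyond the chain the value lies in `[0,1]`). [folklore] -/
theorem chAtC_mem {P : ℕ} {vals : List ℚ} {ℓ : ℕ} {d : CDat} {r : RDat} (h : d.Models P vals ℓ r)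
    (hr : r.ok) (k : ℕ) : (chAtC P d k).mem P ((r.x * r.y) ^ ((1 : ℝ) / 2 ^ (k + 1))) := by
  unfold chAtC
  by_cases hk : k < d.ch.length
  · rw [List.getD_eq_getElem _ _ hk]; exact h.chain k hk
  · rw [List.getD_eq_default _ _ (not_lt.mp hk)]
    obtain ⟨_, hx0, hx1, hy0, hy1⟩ := hr
    have hxy0 : 0 ≤ r.x * r.y := by positivity
    have hxy1 : r.x * r.y ≤ 1 := by nlinarith
    have ht0 : 0 ≤ (r.x * r.y) ^ ((1 : ℝ) / 2 ^ (k + 1)) := Real.rpow_nonneg hxy0 _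
    have ht1 : (r.x * r.y) ^ ((1 : ℝ) / 2 ^ (k + 1)) ≤ 1 := Real.rpow_le_one hxy0 hxy1 (by positivity)
    have h2P : (0 : ℝ) ≤ 2 ^ P := by positivity
    refine ⟨?_, ?_⟩
    · simpa using mul_nonneg ht0 h2P
    · have : (r.x * r.y) ^ ((1 : ℝ) / 2 ^ (k + 1)) * 2 ^ P ≤ 1 * 2 ^ P :=
        mul_le_mul_of_nonneg_right ht1 h2P
      simpa using this

/-- **`dyPow a r ∋ (xy)^{a/2^r}`.** [folklore] -/
theorem dyPow_mem {P : ℕ} {vals : List ℚ} {ℓ : ℕ} {d : CDat} {r : RDat} (h : d.Models P vals ℓ r)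
    (hr : r.ok) : ∀ (rr a : ℕ), (dyPow P d a rr).mem P ((r.x * r.y) ^ ((a : ℝ) / 2 ^ rr))
  | 0, a => by
    have hd : (0 : ℝ) < d.xyd := by exact_mod_cast h.xyd_pos
    have e : (r.x * r.y) ^ ((a : ℝ) / 2 ^ 0) = ((d.xyn ^ a : ℕ) : ℝ) / ((d.xyd ^ a : ℕ) : ℝ) := by
      rw [pow_zero, div_one, Real.rpow_natCast, h.xy_eq, div_pow]; push_cast; ring
    rw [dyPow, e]
    exact NI.mem_ofNatFrac P (Nat.pow_pos h.xyd_pos)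
  | rr + 1, a => by
    have hxy : 0 < r.x * r.y := mul_pos hr.2.1 hr.2.2.2.1
    have ih := dyPow_mem h hr rr (a / 2)
    have hsplit : (a : ℝ) / 2 ^ (rr + 1) = ((a / 2 : ℕ) : ℝ) / 2 ^ rr + ((a % 2 : ℕ) : ℝ) / 2 ^ (rr + 1) := by
      have : (a : ℝ) = 2 * ((a / 2 : ℕ) : ℝ) + ((a % 2 : ℕ) : ℝ) := by exact_mod_cast (Nat.div_add_mod a 2).symm
      rw [this, pow_succ]; field_simp
    simp only [dyPow]
    split_ifs with hpar
    · rw [hsplit, hpar]; simpa using ih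
    · have hodd : a % 2 = 1 := by omega
      rw [hsplit, hodd, Real.rpow_add hxy]
      simpa using NI.mem_mul ih (chAtC_mem h hr rr)

/-- **`brOf ∋ brR N ℓ t x y`** from the two series tables at `h = (t+ℓ)/2`, `h̄ = (t-ℓ)/2 ≥ 0`.
[folklore] -/
theorem brOf_mem {P N ℓ : ℕ} {vals : List ℚ} (hvals : ∀ q ∈ vals, 0 ≤ q) {d : CDat} {r : RDat}
    (h : d.Models P vals ℓ r) {t : ℚ} (ht : (ℓ : ℚ) ≤ t) :
    (brOf P d (Atab P N ((t + ℓ) / 2) (vals.map (NI.ofRat P))) (Atab P N ((t - ℓ) / 2) (vals.map (NI.ofRat P)))).mem P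
      (brR N ℓ (t : ℝ) r.x r.y) := by
  have hh : (0 : ℚ) ≤ (t + ℓ) / 2 := by have : (0 : ℚ) ≤ ℓ := Nat.cast_nonneg ℓ; linarith
  have hhb : (0 : ℚ) ≤ (t - ℓ) / 2 := by linarith
  have A1 := Atab_mem P N hh vals hvals d.ix h.ix_lt
  have A2 := Atab_mem P N hhb vals hvals d.iy h.iy_lt
  have A3 := Atab_mem P N hhb vals hvals d.ix h.ix_lt
  have A4 := Atab_mem P N hh vals hvals d.iy h.iy_lt
  rw [h.x_eq h.ix_lt] at A1 A3
  rw [h.y_eq h.iy_lt] at A2 A4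
  have e1 : ((((t + ℓ) / 2 : ℚ)) : ℝ) = ((t : ℝ) + ℓ) / 2 := by push_cast; ring
  have e2 : ((((t - ℓ) / 2 : ℚ)) : ℝ) = ((t : ℝ) - ℓ) / 2 := by push_cast; ring
  rw [e1] at A1 A4; rw [e2] at A2 A3
  unfold brOf brR
  exact NI.mem_add (NI.mem_mul (NI.mem_mul h.r1 A1) A2) (NI.mem_mul (NI.mem_mul h.r2 A3) A4)

/-! ### A point and a cell -/

/-- A dyadic rational: `t = t.num.toNat / 2^{log₂ t.den}` in `ℝ` when `dyOK t`. [folklore] -/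
theorem dyOK_cast {t : ℚ} (h : dyOK t = true) : (t : ℝ) = (t.num.toNat : ℝ) / 2 ^ Nat.log2 t.den := by
  simp only [dyOK, Bool.and_eq_true, decide_eq_true_eq] at h
  obtain ⟨h0, hden⟩ := h
  rw [rat_cast_eq_toNat_div h0]
  congr 1
  exact_mod_cast hden

/-- **The point enclosures**: at a dyadic `t ≥ ℓ`, entry `d` of `pointC` encloses
`(f_d(t), b_d(t)) = ((xy)^{t/2}, brR N ℓ t x y)`. [folklore] -/
theorem pointC_spec {P N ℓ : ℕ} {vals : List ℚ} (hvals : ∀ q ∈ vals, 0 ≤ q) {cds : List CDat}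
    {rds : List RDat} (h : List.Forall₂ (CDat.Models P vals ℓ) cds rds) (hok : ∀ r ∈ rds, r.ok)
    {t : ℚ} (hdy : dyOK t = true) (ht : (ℓ : ℚ) ≤ t) :
    List.Forall₂ (fun pr r => pr.1.mem P (fC r.x r.y (t : ℝ)) ∧ pr.2.mem P (brR N ℓ (t : ℝ) r.x r.y))
      (pointC P N ℓ (vals.map (NI.ofRat P)) cds t) rds := by
  unfold pointC
  induction h with
  | nil => exact List.Forall₂.nil
  | @cons d r dtl rtl hd _ ih =>
    refine List.Forall₂.cons ⟨?_, brOf_mem hvals hd ht⟩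
      (ih fun r' hr' => hok r' (List.mem_cons_of_mem _ hr'))
    have hp := dyPow_mem hd (hok r List.mem_cons_self) (Nat.log2 t.den + 1) t.num.toNat
    have e : fC r.x r.y (t : ℝ) = (r.x * r.y) ^ ((t.num.toNat : ℝ) / 2 ^ (Nat.log2 t.den + 1)) := by
      rw [fC, dyOK_cast hdy, pow_succ]; congr 1; field_simp
    rw [e]; exact hp

end Summit.CriticalPhenomena.Ising3D.Control2D
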